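import Summits.QuantumFields.YangMills.Theorems.UnitScaleTiltProp7QprimeCombL2Flat
import Summits.QuantumFields.YangMills.Theorems.UnitScaleTiltProp7FlatResidualAlgebra
import Summits.QuantumFields.YangMills.Theorems.UnitScaleTiltProp7Lane2BoxPlateauCutoff
import HarnessLib

/-!
# Route `UnitScaleTilt`, crux K1 «MinimiserStabilityRegPr» (stmt-QuantumFields-19200), EX positivity block, COMB lane — A NEGATIVE LETTER:
# **PRINT'S BASED `ℤ³` COMB KERNEL IS NOT INSIDE THE RESIDUAL ALGEBRA OF RECORD: `ker (QprimeCombL2 … 1) ⊄ N_S(1)`** (so `Q″ := QprimeCombL2 W` is NOT an admissible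
# parameter averaging for ✓`Prop7PosMonotoneInProjector.ker_le_NS_of_intertwining` ∕ `projR_hyps_of_ker_le`, already at the flat member)

Cell `ym3-torus` (HUMAN RULING D-0037; rung R3 — NOT d = 4, NOT infinite volume, NOT a mass gap, NOT Clay).  Width seat `ym3-torus-px13` (gen 9).  THEOREMS ONLY (0 `def`,
0 `sorry`); `--supports stmt-QuantumFields-19200 --as helper`; count-neutral.  Nothing of [B9] §3, N06, `hThm2S`, EX or the crux is asserted or refuted — this closes ONE transfer
route («rows proved with print's comb projector `RcombL2 = projR Δ^η (QprimeCombL2 W)` ⇒ the intrinsic `R_S` rows», bus 2026-08-29T16:48Z), nothing else.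

THE POINT (★★OWNER RULING g29-№18 «HALF-BLOCK OFFSET», made a kernel `¬`).  ✓`Prop7QprimeCombL2.QprimeCombL2_one_eq_zero_iff_siteAvgIter`: at `W = 1` the print-literal comb
`QprimeCombL2` (lit `QprimeIter (zdBlocking 3 L) (bgT L W♯) (K−n)` on the based pullback at `x₀ = basePt F n K`, `val x₀ = (Lᵏ−1)∕2` per axis, ✓`val_basePt`) annihilates `toL2S λ`
iff the `(K−n)`-fold T³ block means of `λ ∘ t_{x₀}` vanish — block means over the torus blocks TRANSLATED by half a block.  ✓`Prop7FlatResidualAlgebra.blockSum_eq_of_mem_NS_one`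
(over ✓`Prop7CombBoxBlockDictionary.QTwS_one_gaugeDir_siteAvgIter`, [Balaban1985BackgroundPropagators] (3.115) at `W = 1`): `toL2S λ ∈ N_S(1)` forces all UNTRANSLATED
`(K−n)`-block sums of `λ` to be equal.  The two-point parameter `λ := δ_a − δ_b`, `a = x₀ + s·𝟙`, `b = a + e₀` (`s = (Lᵏ−1)∕2`, so `val a = Lᵏ−1`, `val b₀ = Lᵏ`): `a − x₀` and
`b − x₀` lie in the SAME block (translated means all `0` ⇒ `toL2S λ ∈ ker (QprimeCombL2 1)`), while `a ∈ Bᵏ(0)`, `b ∈ Bᵏ(e₀)` (untranslated block sums `1` and `−1` ⇒ `toL2S λ ∉ N_S(1)`).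
Needs only `n < K` (one averaging step) — every member, every weight.

WHAT IS PROVED (ns `…Theorems.Prop7KerCombNotLeNS`; member `F`, `n < K`, `h : n ≤ K`, weights `c₀ > 0`, `cB`):
* §1 `transl_left_inj`, `sum_ite_sub_ite` (bookkeeping);
* §2 ★★ `exists_mem_ker_QprimeCombL2_one_not_mem_NS` — an explicit `λ` with `QprimeCombL2 F n K c₀ 1 (toL2S λ) = 0` and `toL2S λ ∉ NS F n K h c₀ cB 1`;
  ★★★ `not_ker_QprimeCombL2_one_le_NS : ¬ (LinearMap.ker (QprimeCombL2 F n K c₀ 1) ≤ NS F n K h c₀ cB 1)`;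
  ★ `not_forall_ker_QprimeCombL2_le_NS` (hence no member-uniform `∀ W, ker (QprimeCombL2 W) ≤ N_S(W)`).
HONEST SCOPE.  Flat member only (which suffices for `¬`); linear algebra over landed letters; no estimate.  For `W ≠ 1` the two combs differ structurally as well (print's `ℤ³` comb:
CORNER base `blockBase L y = L·y`, ONE axial order, lit `B8Eq119TwistedAxial.bgT`; the averaging sequence of record in ✓`Prop7SymAvgTwSGaugeDir.QTwS_gaugeDir_of_avgSeq`: CENTRE base
`emb y`, mean over `Idx P = offsets × Perm × Perm`) — not typed here.  The ADMISSIBLE `Q″` for the intrinsic transfer is the frame-tower top mean itself (★p1 g21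
`…NSOfParallelTopMean.mem_NS_of_topMean_eq_zero`).  Rung R3, not Clay; YM gap NOT proved.

References: T. Bałaban, CMP **99** (1985) 389–434 [Balaban1985BackgroundPropagators] ((3.19)–(3.21) pp.393–394, (3.115) p.418); CMP **95** (1984) 17–40 [Balaban1984PropagatorsI]
((1.20) p.20); CMP **109** (1987) 249–301 [Balaban1987RG1] ((0.1) p.251).
-/

set_option autoImplicit false

noncomputable section

open scoped BigOperators Matrix.Norms.L2Operator

namespace Summit.QuantumFields.YangMills.Theorems.Prop7KerCombNotLeNS

open Literature.MathematicalPhysics.QuantumFieldTheory.Balaban1983to89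
open Literature.MathematicalPhysics.QuantumFieldTheory.Balaban1983to89.T3ContinuumYM3Torus
open B7Prop1Explicit renaming Site → LSite
open B10Eq27TorusAxialLog (transl transl_apply)
open B5Eq118OneStroke (iterBlock mem_iterBlock_iff siteAvgIter_eq_blockSum)
open LatticeFieldCalculus (siteAvgIter)
open B11Eq103H1Complex (SiteL2K)
open Summit.QuantumFields.YangMills.Theorems.Prop7SectET3Transport (periodsT3)
open Summit.QuantumFields.YangMills.Theorems.Prop7SectET3HilbertLetters (W₂ toL2S)
open Summit.QuantumFields.YangMills.Theorems.Prop7SectET3GaugeProjector (NS)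
open Summit.QuantumFields.YangMills.Theorems.Prop7SPrint (basePt)
open Summit.QuantumFields.YangMills.Theorems.Prop7QprimeCombL2 (QprimeCombL2 QprimeCombL2_one_eq_zero_iff_siteAvgIter sitesPerDir_zero_eq)
open Summit.QuantumFields.YangMills.Theorems.Prop7FlatResidualAlgebra (blockSum_eq_of_mem_NS_one)
open Summit.QuantumFields.YangMills.Theorems.Prop7Lane2BoxPlateauCutoff (val_basePt)

/-! ## §1 Bookkeeping: translations are injective; the sum of a two-point function over a finite set -/

section Bookkeeping

variable {P : Params} {j : ℕ}

/-- `x + z = y + z ↔ x = y` on the torus sites. [folklore] -/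
theorem transl_left_inj (x y : Site P j) (z : LSite P.d) : transl x z = transl y z ↔ x = y := by
  constructor
  · intro hxy
    funext ν
    have hν := congrFun hxy ν
    rw [transl_apply, transl_apply] at hν
    exact add_right_cancel hν
  · rintro rfl; rfl

/-- `Σ_{x∈S} (δ_a(x)·E − δ_b(x)·E) = [a ∈ S]·E − [b ∈ S]·E`. [folklore] -/
theorem sum_ite_sub_ite {α M : Type*} [DecidableEq α] [AddCommGroup M] (S : Finset α) (a b : α) (E : M) :
    ∑ x ∈ S, ((if x = a then E else 0) - (if x = b then E else 0)) = (if a ∈ S then E else 0) - (if b ∈ S then E else 0) := by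
  rw [Finset.sum_sub_distrib, Finset.sum_ite_eq' S a (fun _ => E), Finset.sum_ite_eq' S b (fun _ => E)]

end Bookkeeping

/-! ## §2 The two-point witness at the flat member -/

section Witness

variable (F : T3Family) {n K : ℕ}

/-- ★★ **THE WITNESS**: for `n < K` there is a gauge parameter `λ` (the two-point `δ_a − δ_b` of the header) with `QprimeCombL2 F n K c₀ 1 (toL2S λ) = 0` — print's based comb
average annihilates it — and `toL2S λ ∉ N_S(1)` — the residual algebra of record does not contain it.
[cite: Balaban1985BackgroundPropagators, (3.19)-(3.21) pp.393-394, (3.115) p.418; Balaban1984PropagatorsI, (1.20) p.20] -/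
theorem exists_mem_ker_QprimeCombL2_one_not_mem_NS (h : n ≤ K) (hnK : n < K) (c₀ cB : ℝ) [Fact (0 < c₀)] :
    ∃ lam : Site (F.P K) 0 → Matrix (Fin 2) (Fin 2) ℂ,
      QprimeCombL2 F n K c₀ (1 : GaugeField (F.P K) 0 (Matrix.specialUnitaryGroup (Fin 2) ℂ)) (toL2S F K c₀ lam) = 0 ∧
      toL2S F K c₀ lam ∉ NS F n K h c₀ cB (1 : GaugeField (F.P K) 0 (Matrix.specialUnitaryGroup (Fin 2) ℂ)) := by
  classical
  -- the arithmetic of the member: `A = Lᵏ ≥ 2` odd, `N₀ = A·N_k`, `N_k ≥ 2`, `s = (A−1)/2`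
  have hk : K - n ≤ (F.P K).m + (F.P K).K := by show K - n ≤ F.m + K; omega
  have hk0 : K - n ≠ 0 := by omega
  have hL1 : 1 < F.L := F.hL.2
  set A : ℕ := F.L ^ (K - n) with hA
  have hA2 : 2 ≤ A := Nat.one_lt_pow hk0 hL1
  have hAodd : A % 2 = 1 := Nat.odd_iff.mp (F.hL.1.pow)
  set s : ℕ := (F.L ^ (K - n) - 1) / 2 with hs
  have hs2 : 2 * s + 1 = A := by omega
  set N₀ : ℕ := (F.P K).sitesPerDir 0 with hN₀
  set Nk : ℕ := (F.P K).sitesPerDir (K - n) with hNk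
  have hNk2 : 2 ≤ Nk := by
    show 2 ≤ 2 * F.L ^ (F.m + K - (K - n))
    have : 1 ≤ F.L ^ (F.m + K - (K - n)) := Nat.one_le_pow _ _ (by omega)
    omega
  have hN₀eq : N₀ = A * Nk := sitesPerDir_zero_eq F n K h
  have hN₀ : 2 * A ≤ N₀ := by rw [hN₀eq, mul_comm]; exact Nat.mul_le_mul_left A hNk2
  -- the direction `e₀` and the base point's labels
  let i0 : Fin (F.P K).d := ⟨0, Nat.succ_pos 2⟩
  let ℓ : LSite (F.P K).d := fun μ => (((basePt F n K μ).val : ℕ) : ℤ)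
  have hℓ : ∀ μ, ℓ μ = ((s : ℕ) : ℤ) := fun μ => by
    show (((basePt F n K μ).val : ℕ) : ℤ) = ((s : ℕ) : ℤ)
    rw [val_basePt]
  -- the untranslated pair `a′ = s·𝟙`, `b′ = a′ + e₀` and the translated pair `a = a′ + ℓ`, `b = b′ + ℓ`
  let a' : Site (F.P K) 0 := fun _ => ((s : ℕ) : ZMod N₀)
  let b' : Site (F.P K) 0 := Site.shift a' i0
  let a : Site (F.P K) 0 := transl a' ℓ
  let b : Site (F.P K) 0 := transl b' ℓ
  -- their labels
  have hval_a' : ∀ μ, (a' μ).val = s := fun μ => by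
    show (((s : ℕ) : ZMod N₀)).val = s
    rw [ZMod.val_natCast, Nat.mod_eq_of_lt (by omega)]
  have hb'0 : b' i0 = (((s + 1 : ℕ)) : ZMod N₀) := by
    show Function.update a' i0 (a' i0 + 1) i0 = _
    rw [Function.update_self]
    push_cast
    rfl
  have hb'ne : ∀ μ, μ ≠ i0 → b' μ = a' μ := fun μ hμ => by
    show Function.update a' i0 (a' i0 + 1) μ = a' μ
    rw [Function.update_of_ne hμ]
  have hval_b'0 : (b' i0).val = s + 1 := by
    rw [hb'0, ZMod.val_natCast, Nat.mod_eq_of_lt (by omega)]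
  have hval_a : ∀ μ, (a μ).val = 2 * s := fun μ => by
    show (a' μ + ((ℓ μ : ℤ) : ZMod N₀)).val = 2 * s
    rw [hℓ μ, Int.cast_natCast, show a' μ = ((s : ℕ) : ZMod N₀) from rfl, ← Nat.cast_add, ZMod.val_natCast,
      Nat.mod_eq_of_lt (by omega)]
    ring
  have hval_b0 : (b i0).val = A := by
    show (b' i0 + ((ℓ i0 : ℤ) : ZMod N₀)).val = A
    rw [hℓ i0, Int.cast_natCast, hb'0, ← Nat.cast_add, ZMod.val_natCast, Nat.mod_eq_of_lt (by omega)]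
    omega
  have hval_bne : ∀ μ, μ ≠ i0 → (b μ).val = 2 * s := fun μ hμ => by
    show (b' μ + ((ℓ μ : ℤ) : ZMod N₀)).val = 2 * s
    rw [hb'ne μ hμ]
    exact hval_a μ
  -- block labels: `a′`, `b′` in the same `k`-block; `a ∈ Bᵏ(0)`, `b ∈ Bᵏ(e₀)`, not conversely
  have hdiv_a'b' : ∀ μ, (b' μ).val / (F.P K).L ^ (K - n) = (a' μ).val / (F.P K).L ^ (K - n) := fun μ => by
    show (b' μ).val / A = (a' μ).val / A
    by_cases hμ : μ = i0
    · rw [hμ, hval_b'0, hval_a' i0, Nat.div_eq_of_lt (by omega), Nat.div_eq_of_lt (by omega)]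
    · rw [hb'ne μ hμ]
  have hmem_iff : ∀ w : Site (F.P K) (K - n), a' ∈ iterBlock (K - n) w ↔ b' ∈ iterBlock (K - n) w := fun w => by
    rw [mem_iterBlock_iff hk, mem_iterBlock_iff hk]
    simp only [hdiv_a'b']
  have hval_zero : ∀ μ, ((0 : Site (F.P K) (K - n)) μ).val = 0 := fun μ => ZMod.val_zero
  have hval_e0 : ((Site.shift (0 : Site (F.P K) (K - n)) i0) i0).val = 1 := by
    show (Function.update (0 : Site (F.P K) (K - n)) i0 ((0 : Site (F.P K) (K - n)) i0 + 1) i0).val = 1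
    rw [Function.update_self, show ((0 : Site (F.P K) (K - n)) i0) = 0 from rfl, zero_add, ZMod.val_one_eq_one_mod,
      Nat.mod_eq_of_lt (by omega)]
  have hval_ene : ∀ μ, μ ≠ i0 → ((Site.shift (0 : Site (F.P K) (K - n)) i0) μ).val = 0 := fun μ hμ => by
    show (Function.update (0 : Site (F.P K) (K - n)) i0 ((0 : Site (F.P K) (K - n)) i0 + 1) μ).val = 0
    rw [Function.update_of_ne hμ]
    exact ZMod.val_zero
  have ha0 : a ∈ iterBlock (K - n) (0 : Site (F.P K) (K - n)) := by
    rw [mem_iterBlock_iff hk]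
    intro μ
    rw [hval_zero, hval_a, show (F.P K).L ^ (K - n) = A from rfl, Nat.div_eq_of_lt (by omega)]
  have hb0 : b ∉ iterBlock (K - n) (0 : Site (F.P K) (K - n)) := by
    rw [mem_iterBlock_iff hk]
    intro hall
    have h0 := hall i0
    rw [hval_zero, hval_b0, show (F.P K).L ^ (K - n) = A from rfl, Nat.div_self (by omega)] at h0
    exact one_ne_zero h0
  have hae : a ∉ iterBlock (K - n) (Site.shift (0 : Site (F.P K) (K - n)) i0) := by
    rw [mem_iterBlock_iff hk]
    intro hall
    have h0 := hall i0
    rw [hval_e0, hval_a, show (F.P K).L ^ (K - n) = A from rfl, Nat.div_eq_of_lt (by omega)] at h0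
    exact zero_ne_one h0
  have hbe : b ∈ iterBlock (K - n) (Site.shift (0 : Site (F.P K) (K - n)) i0) := by
    rw [mem_iterBlock_iff hk]
    intro μ
    by_cases hμ : μ = i0
    · rw [hμ, hval_e0, hval_b0, show (F.P K).L ^ (K - n) = A from rfl, Nat.div_self (by omega)]
    · rw [hval_ene μ hμ, hval_bne μ hμ, show (F.P K).L ^ (K - n) = A from rfl, Nat.div_eq_of_lt (by omega)]
  -- the witness
  refine ⟨fun x => (if x = a then (1 : Matrix (Fin 2) (Fin 2) ℂ) else 0) - (if x = b then 1 else 0), ?_, ?_⟩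
  · -- translated block means vanish
    rw [QprimeCombL2_one_eq_zero_iff_siteAvgIter h]
    funext w
    simp only [LinearEquiv.symm_apply_apply]
    rw [siteAvgIter_eq_blockSum (K - n) hk]
    have hfun : (fun x : Site (F.P K) 0 => (if transl x ℓ = a then (1 : Matrix (Fin 2) (Fin 2) ℂ) else 0) - (if transl x ℓ = b then 1 else 0))
        = fun x => (if x = a' then (1 : Matrix (Fin 2) (Fin 2) ℂ) else 0) - (if x = b' then 1 else 0) := by
      funext x
      simp only [show a = transl a' ℓ from rfl, show b = transl b' ℓ from rfl, transl_left_inj]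
    rw [hfun, sum_ite_sub_ite]
    have hz : (if a' ∈ iterBlock (K - n) w then (1 : Matrix (Fin 2) (Fin 2) ℂ) else 0) - (if b' ∈ iterBlock (K - n) w then 1 else 0) = 0 := by
      simp only [hmem_iff w, sub_self]
    rw [hz, smul_zero]
    rfl
  · -- untranslated block sums `1 ≠ −1`
    intro hl
    have hsum := blockSum_eq_of_mem_NS_one F n K h c₀ cB _ hl (0 : Site (F.P K) (K - n)) (Site.shift (0 : Site (F.P K) (K - n)) i0)
    rw [sum_ite_sub_ite, sum_ite_sub_ite, if_pos ha0, if_neg hb0, if_neg hae, if_pos hbe, sub_zero, zero_sub] at hsum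
    have h00 := congrFun (congrFun hsum 0) 0
    simp only [Matrix.one_apply_eq, Matrix.neg_apply] at h00
    norm_num at h00

/-- ★★★ **PRINT'S BASED COMB KERNEL IS NOT INSIDE `N_S` AT THE FLAT MEMBER**: for `n < K`, `¬ (ker (QprimeCombL2 F n K c₀ 1) ≤ N_S(1))` — so `Q″ := QprimeCombL2 W` does NOT satisfy the
hypothesis `hker` of ✓`Prop7PosMonotoneInProjector.projR_hyps_of_ker_le` ∕ `pos_laplaceA_of_pos_projR` uniformly in the background (★★OWNER RULING g29-№18's «equal modulo the
half-block translation, not verbatim», sharpened to «not even contained»). [cite: Balaban1985BackgroundPropagators, (3.21) p.394, (3.115) p.418; Balaban1984PropagatorsI, (1.20) p.20] -/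
theorem not_ker_QprimeCombL2_one_le_NS (h : n ≤ K) (hnK : n < K) (c₀ cB : ℝ) [Fact (0 < c₀)] :
    ¬ (LinearMap.ker (QprimeCombL2 F n K c₀ (1 : GaugeField (F.P K) 0 (Matrix.specialUnitaryGroup (Fin 2) ℂ)))
        ≤ NS F n K h c₀ cB (1 : GaugeField (F.P K) 0 (Matrix.specialUnitaryGroup (Fin 2) ℂ))) := by
  intro hle
  obtain ⟨lam, hker, hnot⟩ := exists_mem_ker_QprimeCombL2_one_not_mem_NS F h hnK c₀ cB
  exact hnot (hle (LinearMap.mem_ker.2 hker))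

/-- ★ Hence there is NO member-uniform inclusion `∀ W, ker (QprimeCombL2 W) ≤ N_S(W)` (it fails at `W = 1`). [cite: Balaban1985BackgroundPropagators, (3.21) p.394, (3.115) p.418] -/
theorem not_forall_ker_QprimeCombL2_le_NS (h : n ≤ K) (hnK : n < K) (c₀ cB : ℝ) [Fact (0 < c₀)] :
    ¬ (∀ W : GaugeField (F.P K) 0 (Matrix.specialUnitaryGroup (Fin 2) ℂ), LinearMap.ker (QprimeCombL2 F n K c₀ W) ≤ NS F n K h c₀ cB W) :=
  fun hall => not_ker_QprimeCombL2_one_le_NS F h hnK c₀ cB (hall 1)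

end Witness

end Summit.QuantumFields.YangMills.Theorems.Prop7KerCombNotLeNS

end
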